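import Summits.BirchSwinnertonDyer.Rank1Residual.X12.InertCoreEveryCurve
import Literature.NumberTheory.EllipticCurves.Rank1Residual.Typed.LowerHalfOfLevelDatum
import Literature.NumberTheory.EllipticCurves.Rank1Residual.Typed.X5DescentAnyLevel
import Literature.NumberTheory.EllipticCurves.Rank1Residual.Typed.X5DescentSelmerCore
import Literature.NumberTheory.EllipticCurves.ComplexMultiplicationLFunctionIsogenyHoldsProofs
import Literature.NumberTheory.EllipticCurves.AnalyticRankOrderProofs
import HarnessLib

/-!
# ROUTE-FREE CORE of the descent road to the lower half `ord_p #Ш_an ≤ ord_p #Ш`, analytic rank ≤ 1, any level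
# (cell `bsd-2adic`, seat `bsd-2adic-mult-3` GEN 8; supports item stmt-BirchSwinnertonDyer-19923 `MultLowerHalfAtTwo`)

HONEST FRAMING (run/shared/lean/pub/bsd-2adic/): research route; nothing is booked; BSD is not proved by
any of this. PARTITION: X5@2 (RESIDUAL-MAP B1·O1) × p = 2 — infrastructure for the per-class LOWER-half
doors (items 19923 mult; 19573 / 19271 / 19577 good-ordinary tower classes); closes none.

**What and why.** The GEN 2 door file `Theorems/ByReductionTypeAtTwoMultLowerHalfDescent.lean` (p422308)
proves the squareness-free lower-half door at analytic rank `0`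
(`missingLowerBoundAt_of_rankZero_of_pow_dvd`: `Ш` finite by Gross–Zagier–Kolyvagin, `#Ш_an = q`,
`ord_p q ≤ m`, `p^m ∣ #Ш` ⇒ `MissingLowerBoundAt W p`) and the level-2 / level-3 record shapes — inside a
module that `import`s the route file `Theses.ByReductionTypeAtTwo` (its §4 restates the route declaration
in descent currency). On 2026-08-26 that module had 222 importers (197 `…TowerClass<cls>.lean`, 21
`…TowerT2Display*.lean`, …), 218 of them for that ONE theorem, so every edit of the K4 route file
re-elaborates them all (cell STANDING BUILD RULE, director-bsd 2026-08-26T19:10:10Z: towers, certificate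
shards and record files import Statement / defs / Literature modules, never a `…Theses.<Route>` file).
This module is the route-free home of that road, stated ONCE in the generality the programme actually has:

* §1 `missingLowerBoundAt_of_pow_dvd_of_analyticRank_le_one` — ANY prime, analytic rank `≤ 1` (GZK gives
  `Ш(E/ℚ)` finite there, not only at rank `0`), no Cassels–Tate binder; and its `p = 2` reading
  `missingLowerBoundAt_two_of_analyticRank_le_one` with `#Ш_an = 2^v`, `2^v ∣ #Ш` (the valuation side
  goal pre-discharged — the shape of every record row).
* §2 the record shape at ANY level `k`: `#Ш[2] = 4` and `Ш[2^k] ⊆ 2Ш` ⇒ `4^(k+1) ∣ #Ш`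
  (`two_pow_dvd_shaOrder_of_level`, from the sha-1 count line `card_torsionBy_two_pow_of_two_divisible`),
  and in the SELMER currency the engines print (`two_pow_dvd_shaOrder_of_selmer_level`: `rank = r`,
  `#E(ℚ)[2] = 2^t`, `#Sel⁽²⁾ = 2^{r+t+2}`, every `2^k`-Selmer class lifts to `Sel^(2^(k+1))`). Levels 2 / 3 of
  the GEN 2 file are `k = 1` / `k = 2`.
* §3 per class: `missingLowerBoundAt_two_of_levelMember_of_analyticRank_le_one` (the datum at an isogenous
  member serves the class — Cassels' invariance `X12.missingLowerBoundAt_of_isIsogenous`, route-free module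
  `Rank1Residual.X12.InertCoreEveryCurve`) and `bsdp_two_of_missingUpper_of_pow_dvd_of_analyticRank_le_one`
  (upper half + level datum ⇒ `BSDp W 2`).

RE-POINTING A CLASS FILE (generators of `…TowerClass*.lean` / `…MultTowerClass*.lean` / `…T2Display*.lean`):
replace `import …Theorems.ByReductionTypeAtTwoMultLowerHalfDescent` by
`import …Theorems.ByReductionTypeAtTwoLowerHalfDescentCore` and the term
`missingLowerBoundAt_of_rankZero_of_pow_dvd c 2 hGZK hr hShaAn (m := 4) (by …) hdvd` by
`LowerHalfDescentCore.missingLowerBoundAt_two_of_analyticRank_le_one c hGZK (by omega) hShaAn (v := 4) (by norm_num) hdvd`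
(`hr : c.analyticRank = 0` in scope). Nothing in the GEN 2 file changes (append-only discipline; its names
have 218 users); no statement here restates one of its theorems.

References: [Miller2011LMS] §1, Def. 1.1; [Kolyvagin1990] Thm. A; [Cassels1998] §1; [MerrimanSiksekSmart1996] §4;
[SwinnertonDyer2013] §1; [Stamminger2005] Thm. 6.2.2; [SilvermanAEC2009] Thm. X.4.2; [Cassels1965ArithmeticVIII];
[MilneADT2006] Thm. I.7.3.
-/

set_option autoImplicit false
-- the route's Theorems namespace repeats a component by design (summit = sub-problem, D-0017).
set_option linter.dupNamespace false

noncomputable section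

open scoped Classical

open WeierstrassCurve Literature.NumberTheory.EllipticCurves
  Literature.NumberTheory.EllipticCurves.Rank1Residual
  Literature.NumberTheory.EllipticCurves.Rank1Residual.Typed
  Summit.BirchSwinnertonDyer.Rank1Residual

namespace Summit.BirchSwinnertonDyer.BirchSwinnertonDyer.Theorems.LowerHalfDescentCore

/-! ## §1 The squareness-free door at analytic rank ≤ 1 -/

/-- **Lower half from a divisibility datum, ANY prime, analytic rank `≤ 1` (no Cassels–Tate binder).**
Granted Gross–Zagier–Kolyvagin (`hGZK` = bsd.S17: at analytic rank `≤ 1`, `rank = r_an` and `Ш(E/ℚ)` is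
finite): if `#Ш(E/ℚ)_an` is a rational `q` with `ord_p q ≤ m` and `p^m ∣ #Ш(E/ℚ)`, then
`ord_p #Ш_an ≤ ord_p #Ш` (`MissingLowerBoundAt W p`). Elementary: `p^m ∣ n ≠ 0 ⇒ m ≤ ord_p n`. The GEN 2 door
`Theorems.missingLowerBoundAt_of_rankZero_of_pow_dvd` is the case `r_an = 0`.
[cite: Miller2011LMS, Def. 1.1 (arXiv:1010.2431 p. 3)] [cite: Kolyvagin1990, Thm. A (finiteness of Ш at analytic rank ≤ 1)] -/
theorem missingLowerBoundAt_of_pow_dvd_of_analyticRank_le_one (W : WeierstrassCurve ℚ) [W.IsElliptic]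
    (p : ℕ) [Fact p.Prime] (hGZK : rank_eq_analyticRank_of_analyticRank_le_one) (hr : W.analyticRank ≤ 1)
    {q : ℚ} (hq : shaAn W = (q : ℂ)) {m : ℕ} (hv : padicValRat p q ≤ m) (hdvd : p ^ m ∣ W.shaOrder) :
    MissingLowerBoundAt W p := by
  have hn : W.shaOrder ≠ 0 := (WeierstrassCurve.shaOrder_pos W (hGZK W hr).2).ne'
  have hle : m ≤ padicValNat p W.shaOrder := (padicValNat_dvd_iff_le hn).1 hdvd
  refine ⟨q, hq, hv.trans ?_⟩
  exact_mod_cast hle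

/-- **The `p = 2` record reading: `#Ш_an = 2^v` and `2^v ∣ #Ш` ⇒ the lower half**, analytic rank `≤ 1`
(valuation side goal `ord₂ 2^v = v` discharged here once, instead of at every class file).
[cite: Miller2011LMS, Def. 1.1] [cite: Kolyvagin1990, Thm. A] -/
theorem missingLowerBoundAt_two_of_analyticRank_le_one (W : WeierstrassCurve ℚ) [W.IsElliptic]
    (hGZK : rank_eq_analyticRank_of_analyticRank_le_one) (hr : W.analyticRank ≤ 1)
    {q : ℚ} (hq : shaAn W = (q : ℂ)) {v : ℕ} (hqv : q = 2 ^ v) (hdvd : 2 ^ v ∣ W.shaOrder) :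
    MissingLowerBoundAt W 2 := by
  haveI : Fact (Nat.Prime 2) := ⟨Nat.prime_two⟩
  refine missingLowerBoundAt_of_pow_dvd_of_analyticRank_le_one W 2 hGZK hr hq (m := v) (le_of_eq ?_) hdvd
  rw [hqv, padicValRat.pow, show (2 : ℚ) = ((2 : ℕ) : ℚ) by norm_num, padicValRat.self one_lt_two,
    mul_one]

/-! ## §2 The record shape at any level ⇒ `4^(k+1) ∣ #Ш` -/

/-- **Level-`(k+1)` shape (group currency) ⇒ `2^{2(k+1)} ∣ #Ш`.** `#Ш[2] = 4` and `Ш[2^k] ⊆ 2Ш` (every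
`2^k`-torsion class is twice a class) give `#Ш[2^(k+1)] = 4^(k+1)` (sha-1's uniform count line
`card_torsionBy_two_pow_of_two_divisible`) and Lagrange. `k = 1`: `Ш[2] ⊆ 2Ш ⇒ 2⁴ ∣ #Ш` (engines A/B/F,
Cassels–Tate on `Sel⁽²⁾` trivial); `k = 2`: `Ш[4] ⊆ 2Ш ⇒ 2⁶ ∣ #Ш` (engine G bit `m = 0` / 8-descent).
[cite: Cassels1998, §1] [cite: MerrimanSiksekSmart1996, §4] [cite: SwinnertonDyer2013, §1] -/
theorem two_pow_dvd_shaOrder_of_level (W : WeierstrassCurve ℚ) {k : ℕ}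
    (h2 : Nat.card (AddSubgroup.torsionBy W.sha 2) = 4)
    (hdiv : ∀ y : W.sha, 2 ^ k • y = 0 → ∃ x : W.sha, 2 • x = y) :
    2 ^ (2 * (k + 1)) ∣ W.shaOrder := by
  have hcard : Nat.card (AddSubgroup.torsionBy W.sha (2 ^ (k + 1) : ℕ)) = 4 ^ (k + 1) :=
    card_torsionBy_two_pow_of_two_divisible h2 hdiv
  rw [WeierstrassCurve.shaOrder, pow_mul, show (2 : ℕ) ^ 2 = 4 by norm_num, ← hcard]
  exact AddSubgroup.card_addSubgroup_dvd_card _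

/-- **Level-`(k+1)` shape in SELMER currency ⇒ `2^{2(k+1)} ∣ #Ш`** (what the descent engines print at a
member of Mordell–Weil rank `r`: `#E(ℚ)[2] = 2^t`, `#Sel⁽²⁾(E/ℚ) = 2^{r+t+2}` — so `#Ш[2] = 4`,
`X5.card_sha_two_of_card_selmerTwo` — and every `2^k`-Selmer class lifts to `Sel^(2^(k+1))`, so
`Ш[2^k] ⊆ 2Ш`, `X5.two_divisible_of_selmer_lift_level`).
[cite: SilvermanAEC2009, Thm. X.4.2(a)] [cite: Cassels1998, §1] -/
theorem two_pow_dvd_shaOrder_of_selmer_level (W : WeierstrassCurve ℚ) [W.IsElliptic]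
    [W.IsGloballyMinimal] {r t k : ℕ} (hrank : W.mordellWeilRank = r)
    (ht : Nat.card (AddSubgroup.torsionBy W.toAffine.Point 2) = 2 ^ t)
    (hSel : Nat.card (W.selmerGroup 2) = 2 ^ (r + t + 2))
    (hF : ∀ s : W.selmerGroup (2 ^ k : ℕ), ∃ z : W.selmerGroup (2 ^ (k + 1) : ℕ),
      W.selmerZSMul 2 (two_pow_succ_dvd_mul_two k) z = s) :
    2 ^ (2 * (k + 1)) ∣ W.shaOrder :=
  two_pow_dvd_shaOrder_of_level W (X5.card_sha_two_of_card_selmerTwo W hrank ht hSel)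
    (X5.two_divisible_of_selmer_lift_level W hF)

/-! ## §3 Per class: transport to every member; the two halves ⇒ `BSD(E,2)` -/

/-- **PER CLASS: the lower half at `W` from a level datum at an isogenous member `W₂`**, analytic rank `≤ 1`
at `W` (hence at `W₂`, isogeny invariance of the analytic rank; `Ш(W₂)` finite by GZK): `#Ш_an(W₂) = q`,
`ord₂ q ≤ m`, `2^m ∣ #Ш(W₂)` ⇒ `MissingLowerBoundAt W 2` — §1 at `W₂`, then Cassels' isogeny invariance of
the defect (`X12.missingLowerBoundAt_of_isIsogenous`; `L^{(r)}(W₂,1) ≠ 0` via `leadingLCoeff_ne_zero_holds`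
from the entire continuation `hL`). [cite: Cassels1965ArithmeticVIII] [cite: MilneADT2006, Thm. I.7.3]
[cite: Miller2011LMS, Def. 1.1] -/
theorem missingLowerBoundAt_two_of_levelMember_of_analyticRank_le_one
    (hGZK : rank_eq_analyticRank_of_analyticRank_le_one) (hCassels : bsdRHS_eq_of_isIsogenous)
    (hL : hasEntireLFunction_rat)
    (W : WeierstrassCurve ℚ) [W.IsElliptic] [W.IsGloballyMinimal] (hr : W.analyticRank ≤ 1)
    (W₂ : WeierstrassCurve ℚ) [W₂.IsElliptic] [W₂.IsGloballyMinimal] (hiso : IsIsogenous W W₂)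
    {q : ℚ} (hq : shaAn W₂ = (q : ℂ)) {m : ℕ} (hv : padicValRat 2 q ≤ m)
    (hdvd : 2 ^ m ∣ W₂.shaOrder) : MissingLowerBoundAt W 2 := by
  haveI : Fact (Nat.Prime 2) := ⟨Nat.prime_two⟩
  have hr₂ : W₂.analyticRank ≤ 1 := by rw [← analyticRank_eq_of_isIsogenous' hiso]; exact hr
  have hfin₂ : Finite W₂.sha := (hGZK W₂ hr₂).2
  exact X12.missingLowerBoundAt_of_isIsogenous hCassels hiso hfin₂
    (W₂.leadingLCoeff_ne_zero_holds (hL W₂))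
    (missingLowerBoundAt_of_pow_dvd_of_analyticRank_le_one W₂ 2 hGZK hr₂ hq hv hdvd)

/-- **Per curve: upper half + level datum ⇒ `BSD(E,2)`** at analytic rank `≤ 1` (GZK): the two halves make
Miller's last clause (`missingPPartAt_of_lower_of_upper`, `bsdp_of_missingPPartAt`).
[cite: Miller2011LMS, §1 and Def. 1.1] -/
theorem bsdp_two_of_missingUpper_of_pow_dvd_of_analyticRank_le_one
    (hGZK : rank_eq_analyticRank_of_analyticRank_le_one)
    (W : WeierstrassCurve ℚ) [W.IsElliptic] [W.IsGloballyMinimal] (hr : W.analyticRank ≤ 1)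
    (hU : MissingUpperBoundAt W 2) {q : ℚ} (hq : shaAn W = (q : ℂ)) {m : ℕ}
    (hv : padicValRat 2 q ≤ m) (hdvd : 2 ^ m ∣ W.shaOrder) : BSDp W 2 := by
  haveI : Fact (Nat.Prime 2) := ⟨Nat.prime_two⟩
  exact bsdp_of_missingPPartAt W 2 hGZK hr
    (missingPPartAt_of_lower_of_upper W 2
      (missingLowerBoundAt_of_pow_dvd_of_analyticRank_le_one W 2 hGZK hr hq hv hdvd) hU)

end Summit.BirchSwinnertonDyer.BirchSwinnertonDyer.Theorems.LowerHalfDescentCore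

end
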